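/-
Copyright (c) 2026 the pub-hodgecm-mathlib formalisation cell (harness21).  Prover seat hodgecm-mathlib-K2Liu-p02 (g0),
Track B «K2-LIT» ∕ hLiu418 #184♮, unit U3a «SIEGEL EISENSTEIN SERIES» of the K2_Liu road, socket #10a: payment of
`K2LiuCurveThetaSigsU3aSiegelEisenstein.sig_K2LiuSiegelCharacterTrivialOnRational` — THE INDUCING CHARACTER OF THE
SIEGEL–HERMITIAN EISENSTEIN SERIES IS TRIVIAL ON THE RATIONAL SIEGEL PARABOLIC.  2026-09-03.
-/
import Literature.NumberTheory.K2Lit.SiegelEisensteinSeriesDoubled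
import Literature.NumberTheory.GelbartRogawski1991.DoubledWeilRepresentationRationalSchur
import HarnessLib

/-!
# K2_Liu road (hLiu418 = stmt-HodgeConjecture-24832), unit U3a «SIEGEL EISENSTEIN», socket #10a:
# `χ(det_Δ γ) · |det_Δ γ|_{𝔸_L}^{s + n/2} = 1` for `γ ∈ H(L⁺)` — the inducing character is trivial on rational points

Cell `pub/hodgecm-mathlib` (D-0151), Track B (21-frontier RULING «PUSH BOTH» 2026-09-03; LEAD F0P6-plan DEAL BY NAME
2026-09-03T20:51:45Z: #10a ↦ base K2Liu-p02), socket module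
`Summits/HodgeConjecture/HodgeConjecture/Cruxes/HLiu418/Lines/K2_Liu_CurveThetaSigs_U3a_SiegelEisenstein.lean` (planner
K2Liu-plan (g0), referee box K2Liu-ref1 BOX #4), socket **`sig_K2LiuSiegelCharacterTrivialOnRational`** (#10a, S–M):
for the doubled unitary group `H = U(𝕍 ⊕ −𝕍)` of the CM datum of record (★ `GRConstruction.HA`, `ratH = H(L⁺)`),
a Hecke character `χ` of `L`, `s ∈ ℂ` and a RATIONAL `γ ∈ H(L⁺)` (in the Siegel parabolic `P_Δ`), the character
`siegelDeltaCharacter χ s = χ(det_Δ ·) · |det_Δ ·|_{𝔸_L}^{s + n/2}` inducing the degenerate principal series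
`I(s, χ)` (★ `K2Lit.SiegelDoubled.siegelDeltaCharacter`, p854694) takes the value `1` at `γ`.  This is what makes the
summand `f(γ h)` of the Siegel–hermitian Eisenstein series `E(h; f) = Σ_{γ ∈ P_Δ(L⁺)\H(L⁺)} f(γ h)` (Liu 2021 §B.3
`E_{P_a}(·; f_{a,s})` at `a = 0`; Tan 1999 §1) independent of the coset representative (socket #10b).

THE MATHEMATICS.  For `γ = γ₀ ⊗ 1 ∈ H(L⁺)`, `det_Δ γ = det(γ₁₁ + γ₁₂) ⊗ 1 = algebraMap L 𝔸_L d` with `d ∈ L`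
(★ `detDelta_toAdelic`).  If `det_Δ γ` is a unit of `𝔸_L` then `d ≠ 0` and `det_Δ γ` is the PRINCIPAL idele of `d`
(★ `detDelta_unit_mem_principalIdeles`), so `χ(det_Δ γ) = 1` because a Hecke character is trivial on `L^×`
(★ `HeckeCharacter.map_principal`) and `|det_Δ γ|_{𝔸_L} = 1` by the PRODUCT FORMULA
(★ `ideleNorm_eq_one_of_mem_principalIdeles`); hence `χ(det_Δ γ)·|det_Δ γ|^{s+n/2} = 1 · 1^{2s+n} = 1`.  If `det_Δ γ`
is not a unit, both ★ `chiDet` and ★ `modDelta` take their total-definition value `1` and the character is again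
`1 · 1^{2s+n} = 1`.  In particular the socket's hypothesis `γ ∈ P_Δ` is not needed (K2Liu-ref1 BOX #4: «hyp
`IsSiegelDelta γ` UNNECESSARY (holds for every rational γ; harmless)»); the statement is paid as frozen, and §1
records the hypothesis-free form for #10b.  (The same computation, with exponent `1/2` instead of `s + n/2`, is
★ `chiDet_mul_modDelta_eq_one_of_rational`, the rational clause of the doubled Weil representation.)

* §1 `chiDet_eq_one_of_mem_ratH`, `modDelta_eq_one_of_mem_ratH`, `siegelDeltaCharacter_eq_one_of_mem_ratH`
  (no parabolic hypothesis — the form #10b consumes).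
* §2 **`siegelCharacterTrivialOnRational`** — `sig_K2LiuSiegelCharacterTrivialOnRational` TOKEN FOR TOKEN.

HONEST LABEL: HC_CM is proved only modulo the 7 printed citations (2 remaining named inputs: hLiu418 =
stmt-HodgeConjecture-24832, h413 = stmt-HodgeConjecture-24833) until rung 0 closes; this file is a
`--supports stmt-HodgeConjecture-24832` helper (floored scaffold of the K2_Liu road) and retires nothing by itself.
-/

noncomputable section

open scoped Matrix
open NumberField IsDedekindDomain

namespace Summit.HodgeConjecture.HodgeConjecture.Cruxes.HLiu418.K2LiuSiegelCharacterTrivialOnRational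

open Literature.NumberTheory.Automorphic Literature.NumberTheory.GaloisRepresentations
open Literature.NumberTheory.GelbartRogawski1991 Literature.NumberTheory.GelbartRogawski1991.GRConstruction
open Literature.NumberTheory.K2Lit.SiegelDoubled

variable {L : Type} [Field L] [NumberField L] [IsCMField L]
variable {N M n : ℕ} {e : Fin N × Fin M ≃ Fin n}
  {dV : Fin N → L} {hdV : ∀ i, IsCMField.complexConj L (dV i) = dV i}
  {dW : Fin M → L} {hdW : ∀ i, IsCMField.complexConj L (dW i) = dW i}

/-! ## §1  `χ(det_Δ γ) = 1` and `|det_Δ γ| = 1` on `H(L⁺)` -/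

/-- **`χ(det_Δ γ) = 1` for rational `γ ∈ H(L⁺)`**: either `det_Δ γ` is a unit, then it is a principal idele
(★ `detDelta_unit_mem_principalIdeles`) on which a Hecke character is trivial (★ `HeckeCharacter.map_principal`), or it
is not, and ★ `chiDet` is `1` by definition. [cite: Liu2021, §B.3 p. 101] [cite: Tan1999, §1] -/
theorem chiDet_eq_one_of_mem_ratH (χ : HeckeCharacter L) {p : HA L e dV hdV dW hdW}
    (hp : p ∈ ratH L e dV hdV dW hdW) : chiDet L e dV hdV dW hdW χ p = 1 := by
  unfold chiDet
  by_cases hu : IsUnit (detDelta L e dV hdV dW hdW p)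
  · rw [dif_pos hu]
    exact HeckeCharacter.map_principal χ (detDelta_unit_mem_principalIdeles L e dV hdV dW hdW p hp hu)
  · rw [dif_neg hu]

/-- **`|det_Δ γ|_{𝔸_L}^{1/2} = 1` for rational `γ ∈ H(L⁺)`** — the PRODUCT FORMULA
(★ `ideleNorm_eq_one_of_mem_principalIdeles`) on the principal idele `det_Δ γ` (★ `detDelta_unit_mem_principalIdeles`),
or the total-definition value `1` of ★ `modDelta` off units. [cite: Liu2021, §B.3 p. 101] [cite: Tan1999, §1] -/
theorem modDelta_eq_one_of_mem_ratH {p : HA L e dV hdV dW hdW} (hp : p ∈ ratH L e dV hdV dW hdW) :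
    modDelta L e dV hdV dW hdW p = 1 := by
  unfold modDelta
  by_cases hu : IsUnit (detDelta L e dV hdV dW hdW p)
  · rw [dif_pos hu, ideleNorm_eq_one_of_mem_principalIdeles
      (detDelta_unit_mem_principalIdeles L e dV hdV dW hdW p hp hu)]
    simp
  · rw [dif_neg hu]

/-- **The inducing character is `1` on ALL of `H(L⁺)`** (no parabolic hypothesis):
`χ(det_Δ γ) · |det_Δ γ|^{s + n/2} = 1 · 1^{2s + n} = 1`.  This is the form socket #10b (left `H(L⁺)`-invariance
of the Eisenstein series) consumes. [cite: Liu2021, §B.3 p. 101] [cite: Tan1999, §1] -/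
theorem siegelDeltaCharacter_eq_one_of_mem_ratH (χ : HeckeCharacter L) (s : ℂ) {p : HA L e dV hdV dW hdW}
    (hp : p ∈ ratH L e dV hdV dW hdW) : siegelDeltaCharacter L e dV hdV dW hdW χ s p = 1 := by
  unfold siegelDeltaCharacter
  rw [chiDet_eq_one_of_mem_ratH χ hp, modDelta_eq_one_of_mem_ratH hp]
  simp

/-! ## §2  The head -/

/-- **PAYMENT OF `sig_K2LiuSiegelCharacterTrivialOnRational`** (socket #10a of unit U3a «SIEGEL EISENSTEIN» of the
K2_Liu road, `Cruxes/HLiu418/Lines/K2_Liu_CurveThetaSigs_U3a_SiegelEisenstein.lean`, TOKEN FOR TOKEN): for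
`γ ∈ P_Δ(L⁺) = P_Δ(𝔸) ∩ H(L⁺)`, `χ(det_Δ γ) · |det_Δ γ|_{𝔸_L}^{s + n/2} = 1` — `det_Δ γ` is a principal idele, `χ` is
trivial on `L^×` and the product formula kills the modulus (§1; the parabolic hypothesis is carried, not used).
[cite: Liu2021, §B.3 p. 101] [cite: Tan1999, §1] -/
theorem siegelCharacterTrivialOnRational :
    ∀ (L : Type) [Field L] [NumberField L] [IsCMField L] {N M n : ℕ} (e : Fin N × Fin M ≃ Fin n)
      (dV : Fin N → L) (hdV : ∀ i, IsCMField.complexConj L (dV i) = dV i)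
      (dW : Fin M → L) (hdW : ∀ i, IsCMField.complexConj L (dW i) = dW i)
      (χ : HeckeCharacter L) (s : ℂ) (γ : ratH L e dV hdV dW hdW),
      IsSiegelDelta L e dV hdV dW hdW (γ : HA L e dV hdV dW hdW) →
        siegelDeltaCharacter L e dV hdV dW hdW χ s (γ : HA L e dV hdV dW hdW) = 1 := by
  intro L _ _ _ N M n e dV hdV dW hdW χ s γ _
  exact siegelDeltaCharacter_eq_one_of_mem_ratH χ s γ.2

end Summit.HodgeConjecture.HodgeConjecture.Cruxes.HLiu418.K2LiuSiegelCharacterTrivialOnRational
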